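import Literature.AlgebraicGeometry.Deligne1982.WeilTypeCMGeneralMemberIsogenyClass
import Literature.AlgebraicGeometry.Deligne1982.WeilTypeCMGeneralMemberEndomorphismField
import Literature.AlgebraicGeometry.Deligne1982.WeilTypeCMWeilClassesHodge
import Literature.AlgebraicGeometry.HodgeTheory.WeilEigenlinesIsogenyTransport
import Literature.AlgebraicGeometry.HodgeTheory.WeilClassesFieldIsogenyInvariance
import HarnessLib

/-!
# The general CM-Weil abelian variety: the Hodge conjecture is exactly the algebraicity of the Weil classes; criteria of non-generality

Deligne [Deligne1982HodgeCycles, §4–5 and Milne's 2003 re-edition endnote 16], Milne [Milne2025AbelianMotivesCharP, §1.5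
Example 1.17]: «for a general `A` (of Weil type relative to the CM field `Q`, `Hg = SU(φ)`), the Weil classes are Hodge
classes …; if the Weil classes are algebraic, then the Hodge conjecture holds for `A`». In the tree's typing
(`IsWeilTypeCM A η R e₀ k`, `IsPolarizationClass`, `IsRosatiCM`, «`Hg = SU(φ)`» = `HasHodgeGroupSUCM A η P_R h`) the «if»
is the tree's `IsWeilTypeCM.hodgeConjectureFor_of_hodgeGroupSU` (under the standing multiplicativity hypothesis `hcup` on
the algebraic classes, see `HodgeTheory/AlgebraicClassesCup`), and the «only if» is `IsWeilTypeCM.weilClassesField_le_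
algebraicClasses_of_hodgeConjectureFor` (the Weil classes are Hodge classes, Deligne 4.4–4.5). This file records the
resulting EQUIVALENCE, for the general member, for its `E`-isogeny class and for its plain isogeny class (van Geemen 3.7:
the Hodge conjecture and the algebraicity of `W_E` are isogeny invariants), the transport of the multiplicativity
hypothesis `hcup` along isogenies, and — contrapositives of `WeilTypeCMGeneralMemberEndomorphismField` — CRITERIA OF
NON-GENERALITY: a CM-Weil `(A, η, h)` with `2k ≥ 4` which is of CM type, or not simple, or without factor of type IV, or
with `[End⁰(A) : ℚ] ≠ 2e₀`, or with two non-commuting endomorphisms, is NOT a general member (`Hg(A) ≠ SU(φ)`).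

## What (all `theorem`s, no new definitions, no new facts)

* §1 `IsEvenCupSubalgebra.map_of_hom`, `IsEvenCupSubalgebra.comap_of_hom` (even cup subalgebras push forward / pull back
  along `f^*`, Hatcher Prop. 3.10), **`isEvenCupSubalgebra_algebraicClasses_of_isIsogeny`** /`'`/`_iff_` (multiplicativity of
  the algebraic classes is an isogeny invariant: `f^*(Nᵖ(B)) = Nᵖ(A)`, tree `algebraicClasses_map_eq_of_isIsogeny`).
* §2 **`IsWeilTypeCM.hodgeConjectureFor_iff_weilClasses_of_hodgeGroupSU`** (`HC(A) ⟺` every rational Weil class is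
  algebraic), **`IsWeilTypeCM.hodgeConjectureFor_iff_weilClassesField_le_of_hodgeGroupSU`** (`HC(A) ⟺ W_E ⊗ ℂ ⊆ Nᵏ(A)`),
  **`hodgeConjectureFor_iff_weilClassesField_le_of_isIsogenous_of_hasHodgeGroupSUCM`** (`C ∼ A`: `HC(C) ⟺ W_E(A) ⊗ ℂ ⊆ Nᵏ(A)`),
  `hodgeConjectureFor_iff_weilClassesField_le_of_isIsogeny_of_hasHodgeGroupSUCM` (`E`-isogeny `f : A ⟶ B` to a general
  `(B, θ, h)`: `HC(A) ⟺ W_E(A) ⊗ ℂ ⊆ Nᵏ(A) ⟺ W_E(B) ⊗ ℂ ⊆ Nᵏ(B)`), `hodgeConjectureFor_of_isIsogeny_of_hasHodgeGroupSUCM_of_le`.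
* §3 **`not_hasHodgeGroupSUCM_of_isOfCMType`**, **`not_hasHodgeGroupSUCM_of_not_isSimple`**,
  **`not_hasHodgeGroupSUCM_of_hasNoTypeIVFactor`**, `not_hasHodgeGroupSUCM_of_finrank_endAlgebra_ne`,
  `not_hasHodgeGroupSUCM_of_not_isField_endAlgebra`, `not_hasHodgeGroupSUCM_of_comp_ne_comp`,
  `not_hasHodgeGroupSUCM_of_endAlgebra_mul_ne` (`2 ≤ k`).

## References

* [Deligne1982HodgeCycles] P. Deligne, *Hodge cycles on abelian varieties*, LNM 900 (1982), §4 (4.4)–(4.5), (4.8), §5;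
  Milne's 2003 re-edition, endnote 16.
* [Milne2025AbelianMotivesCharP] J. S. Milne, *Abelian motives in characteristic p*, arXiv:2508.09972, §1.5 1.15 and Example 1.17
  (chunk p0006 L76–L97 and L120–L150).
* [vanGeemen1994HodgeAV] B. van Geemen, in: *Algebraic Cycles and Hodge Theory*, LNM 1594 (1994), 3.6–3.7 (p. 236), 6.12.
* [MoonenZarhin1998WeilClasses] B. Moonen, Yu. Zarhin, *Weil classes on abelian varieties*, Crelle 496 (1998), §1.
* [HatcherAT2002] A. Hatcher, *Algebraic Topology* (2002), Prop. 3.10.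
-/

noncomputable section

open CategoryTheory Polynomial
open Literature.AlgebraicTopology.SingularHomology
open Literature.AlgebraicGeometry.Motives
open Literature.AlgebraicGeometry.HodgeTheory
open Literature.AlgebraicGeometry.VanGeemen1994
open Literature.AlgebraicGeometry.Milne1999
open Literature.AlgebraicGeometry.ComplexMultiplication

namespace Literature.AlgebraicGeometry.Deligne1982

/-! ### §1 Multiplicativity of the algebraic classes along isogenies -/

section CupSubalgebra

variable {A B : AbelianVariety ℂ} {f : A ⟶ B}

/-- **Even cup subalgebras push forward along `f^*`**: for `f : A ⟶ B` and an even cup subalgebra `G'` of `H^{2•}(B(ℂ); ℂ)`,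
`f^* G' = (p ↦ f^*(G'ᵖ))` is an even cup subalgebra of `H^{2•}(A(ℂ); ℂ)` (`f^* 1 = 1`, `f^*(a ⌣ b) = f^*a ⌣ f^*b`).
[cite: HatcherAT2002, Prop. 3.10] -/
theorem IsEvenCupSubalgebra.map_of_hom
    {G' : (p : ℕ) → Submodule ℂ (complexBetti B.X (2 * p))} (hG' : IsEvenCupSubalgebra B.X G') (f : A ⟶ B) :
    IsEvenCupSubalgebra A.X (fun p => (G' p).map (complexBetti.map f.hom.hom.hom (2 * p)).hom) where
  one_mem := ⟨singularCohomology.one ℂ (Motives.ComplexPoints B.X), hG'.one_mem, singularCohomology.map_one _⟩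
  cup_mem p q a b ha hb := by
    obtain ⟨a, ha, rfl⟩ := ha
    obtain ⟨b, hb, rfl⟩ := hb
    exact ⟨cupProduct (two_mul_add_two_mul p q) a b, hG'.cup_mem ha hb, cupProduct_map _ _ a b⟩

/-- **Even cup subalgebras pull back along `f^*`**: `(f^*)⁻¹ G = (p ↦ (f^*)⁻¹(Gᵖ))` is an even cup subalgebra of
`H^{2•}(B(ℂ); ℂ)` for every even cup subalgebra `G` of `H^{2•}(A(ℂ); ℂ)`. [cite: HatcherAT2002, Prop. 3.10] -/
theorem IsEvenCupSubalgebra.comap_of_hom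
    {G : (p : ℕ) → Submodule ℂ (complexBetti A.X (2 * p))} (hG : IsEvenCupSubalgebra A.X G) (f : A ⟶ B) :
    IsEvenCupSubalgebra B.X (fun p => (G p).comap (complexBetti.map f.hom.hom.hom (2 * p)).hom) where
  one_mem := by
    change complexBetti.map f.hom.hom.hom (2 * 0) (singularCohomology.one ℂ (Motives.ComplexPoints B.X)) ∈ G 0
    have e : complexBetti.map f.hom.hom.hom (2 * 0) (singularCohomology.one ℂ (Motives.ComplexPoints B.X)) =
        singularCohomology.one ℂ (Motives.ComplexPoints A.X) :=
      singularCohomology.map_one _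
    rw [e]
    exact hG.one_mem
  cup_mem p q a b ha hb := by
    change complexBetti.map f.hom.hom.hom (2 * (p + q)) (cupProduct (two_mul_add_two_mul p q) a b) ∈ G (p + q)
    have e : complexBetti.map f.hom.hom.hom (2 * (p + q)) (cupProduct (two_mul_add_two_mul p q) a b) =
        cupProduct (two_mul_add_two_mul p q) (complexBetti.map f.hom.hom.hom (2 * p) a)
          (complexBetti.map f.hom.hom.hom (2 * q) b) :=
      cupProduct_map _ _ a b
    rw [e]
    exact hG.cup_mem ha hb

/-- **Multiplicativity of the algebraic classes descends along an isogeny** `f : A ⟶ B`: if `N•(B) ⊗ ℂ` is closed under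
cup products then so is `N•(A) ⊗ ℂ = f^*(N•(B) ⊗ ℂ)` (tree `algebraicClasses_map_eq_of_isIsogeny`).
[cite: vanGeemen1994HodgeAV, 3.6–3.7 (p. 236)] [cite: HatcherAT2002, Prop. 3.10] -/
theorem isEvenCupSubalgebra_algebraicClasses_of_isIsogeny (hf : AbelianVariety.IsIsogeny f)
    (hcup : IsEvenCupSubalgebra B.X (fun p => algebraicClasses B.X p)) :
    IsEvenCupSubalgebra A.X (fun p => algebraicClasses A.X p) := by
  have h := hcup.map_of_hom f
  simp only [algebraicClasses_map_eq_of_isIsogeny hf] at h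
  exact h

/-- … **and ascends**: if `N•(A) ⊗ ℂ` is closed under cup products then so is `N•(B) ⊗ ℂ = (f^*)⁻¹(N•(A) ⊗ ℂ)` (`f^*` is
injective, tree `complexBetti_map_bijective_of_isIsogeny`). [cite: vanGeemen1994HodgeAV, 3.6–3.7 (p. 236)]
[cite: HatcherAT2002, Prop. 3.10] -/
theorem isEvenCupSubalgebra_algebraicClasses_of_isIsogeny' (hf : AbelianVariety.IsIsogeny f)
    (hcup : IsEvenCupSubalgebra A.X (fun p => algebraicClasses A.X p)) :
    IsEvenCupSubalgebra B.X (fun p => algebraicClasses B.X p) := by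
  have h := hcup.comap_of_hom f
  have e : ∀ p, (algebraicClasses A.X p).comap (complexBetti.map f.hom.hom.hom (2 * p)).hom = algebraicClasses B.X p :=
    fun p ↦ by
      rw [← algebraicClasses_map_eq_of_isIsogeny hf p, Submodule.comap_map_eq_of_injective]
      exact fun x y hxy ↦ (complexBetti_map_bijective_of_isIsogeny hf _).1 hxy
  simp only [e] at h
  exact h

/-- **Multiplicativity of the algebraic classes is an isogeny invariant.** [cite: vanGeemen1994HodgeAV, 3.6–3.7 (p. 236)]
[cite: HatcherAT2002, Prop. 3.10] -/
theorem isEvenCupSubalgebra_algebraicClasses_iff_of_isIsogeny (hf : AbelianVariety.IsIsogeny f) :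
    IsEvenCupSubalgebra A.X (fun p => algebraicClasses A.X p) ↔ IsEvenCupSubalgebra B.X (fun p => algebraicClasses B.X p) :=
  ⟨isEvenCupSubalgebra_algebraicClasses_of_isIsogeny' hf, isEvenCupSubalgebra_algebraicClasses_of_isIsogeny hf⟩

end CupSubalgebra

/-! ### §2 For the general member, the Hodge conjecture is the algebraicity of the Weil classes -/

section HodgeConjectureIff

variable {A : AbelianVariety ℂ} {η : A ⟶ A} {R : Polynomial ℤ} {e₀ k : ℕ} {h : complexBetti A.X 2}

/-- **`HC(A) ⟺ every rational Weil class of `A` is algebraic**, for a general CM-Weil `(A, η, h)` (`Hg(A) = SU(φ)`),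
under the multiplicativity hypothesis `hcup` on the algebraic classes: «⟸» is Deligne's endnote-16 reduction (tree
`IsWeilTypeCM.hodgeConjectureFor_of_hodgeGroupSU`), «⟹» holds because the Weil classes are Hodge classes (Deligne 4.4–4.5,
tree `IsWeilTypeCM.weilClassesField_le_algebraicClasses_of_hodgeConjectureFor`).
[cite: Milne2025AbelianMotivesCharP, §1.5 Example 1.17 («if the Weil classes are algebraic, then the Hodge conjecture holds for A»)]
[cite: Deligne1982HodgeCycles, §4 (4.4)–(4.5) and Milne 2003 re-edition endnote 16] -/
theorem IsWeilTypeCM.hodgeConjectureFor_iff_weilClasses_of_hodgeGroupSU (hW : IsWeilTypeCM A η R e₀ k)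
    (hpol : IsPolarizationClass A.dim A.X h) (hRos : IsRosatiCM A η h) (hSU : HasHodgeGroupSUCM A η (R.comp (X ^ 2)) h)
    (hcup : IsEvenCupSubalgebra A.X (fun p => algebraicClasses A.X p)) :
    HodgeConjectureFor A.dim A.X ↔
      ∀ c ∈ weilClassesField A η (R.comp (X ^ 2)) (2 * k), IsRationalClass c → c ∈ algebraicClasses A.X k :=
  ⟨fun hHC _ hc _ ↦ hW.weilClassesField_le_algebraicClasses_of_hodgeConjectureFor hHC hc,
    hW.hodgeConjectureFor_of_hodgeGroupSU hpol hRos hSU hcup⟩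

/-- **`HC(A) ⟺ W_E(A) ⊗ ℂ ⊆ Nᵏ(A) ⊗ ℂ`** for a general CM-Weil `(A, η, h)` (under `hcup`).
[cite: Milne2025AbelianMotivesCharP, §1.5 Example 1.17] [cite: Deligne1982HodgeCycles, §4 (4.4)–(4.5) and Milne 2003 re-edition endnote 16] -/
theorem IsWeilTypeCM.hodgeConjectureFor_iff_weilClassesField_le_of_hodgeGroupSU (hW : IsWeilTypeCM A η R e₀ k)
    (hpol : IsPolarizationClass A.dim A.X h) (hRos : IsRosatiCM A η h) (hSU : HasHodgeGroupSUCM A η (R.comp (X ^ 2)) h)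
    (hcup : IsEvenCupSubalgebra A.X (fun p => algebraicClasses A.X p)) :
    HodgeConjectureFor A.dim A.X ↔ weilClassesField A η (R.comp (X ^ 2)) (2 * k) ≤ algebraicClasses A.X k :=
  ⟨hW.weilClassesField_le_algebraicClasses_of_hodgeConjectureFor,
    fun hle ↦ hW.hodgeConjectureFor_of_hodgeGroupSU hpol hRos hSU hcup fun _ hc _ ↦ hle hc⟩

/-- **On the isogeny class of a general CM-Weil `(A, η, h)`: `HC(C) ⟺ W_E(A) ⊗ ℂ ⊆ Nᵏ(A) ⊗ ℂ`** for every `C ∼ A`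
(the Hodge conjecture is an isogeny invariant, van Geemen 3.7, tree `hodgeConjectureFor_iff_of_isIsogenous`).
[cite: vanGeemen1994HodgeAV, 3.6–3.7 Lemma 3.7 (p. 236)] [cite: Milne2025AbelianMotivesCharP, §1.5 Example 1.17]
[cite: Deligne1982HodgeCycles, Milne 2003 re-edition endnote 16] -/
theorem hodgeConjectureFor_iff_weilClassesField_le_of_isIsogenous_of_hasHodgeGroupSUCM {C : AbelianVariety ℂ}
    (hW : IsWeilTypeCM A η R e₀ k) (hpol : IsPolarizationClass A.dim A.X h) (hRos : IsRosatiCM A η h)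
    (hSU : HasHodgeGroupSUCM A η (R.comp (X ^ 2)) h) (hcup : IsEvenCupSubalgebra A.X (fun p => algebraicClasses A.X p))
    (hC : AbelianVariety.IsIsogenous C A) :
    HodgeConjectureFor C.dim C.X ↔ weilClassesField A η (R.comp (X ^ 2)) (2 * k) ≤ algebraicClasses A.X k :=
  (hodgeConjectureFor_iff_of_isIsogenous hC).trans
    (hW.hodgeConjectureFor_iff_weilClassesField_le_of_hodgeGroupSU hpol hRos hSU hcup)

/-- … and `HC(C)` for `C ∼ A` iff every rational Weil class of `A` is algebraic. [cite: vanGeemen1994HodgeAV, 3.6–3.7 Lemma 3.7 (p. 236)]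
[cite: Milne2025AbelianMotivesCharP, §1.5 Example 1.17] -/
theorem hodgeConjectureFor_iff_weilClasses_of_isIsogenous_of_hasHodgeGroupSUCM {C : AbelianVariety ℂ}
    (hW : IsWeilTypeCM A η R e₀ k) (hpol : IsPolarizationClass A.dim A.X h) (hRos : IsRosatiCM A η h)
    (hSU : HasHodgeGroupSUCM A η (R.comp (X ^ 2)) h) (hcup : IsEvenCupSubalgebra A.X (fun p => algebraicClasses A.X p))
    (hC : AbelianVariety.IsIsogenous C A) :
    HodgeConjectureFor C.dim C.X ↔
      ∀ c ∈ weilClassesField A η (R.comp (X ^ 2)) (2 * k), IsRationalClass c → c ∈ algebraicClasses A.X k :=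
  (hodgeConjectureFor_iff_of_isIsogenous hC).trans (hW.hodgeConjectureFor_iff_weilClasses_of_hodgeGroupSU hpol hRos hSU hcup)

variable {B : AbelianVariety ℂ} {f : A ⟶ B} {θ : B ⟶ B} {h' : complexBetti B.X 2}

/-- **Along an `E`-equivariant isogeny `f : A ⟶ B` to a general CM-Weil `(B, θ, h')`: `HC(A) ⟺ W_E(A) ⊗ ℂ ⊆ Nᵏ(A) ⊗ ℂ`**
(`hcup` on `B`, transported to `A` by §1; the four hypotheses transported by `weilTypeCM_generalMember_portrait_of_isIsogeny`).
[cite: vanGeemen1994HodgeAV, 3.6–3.7 (p. 236) and Lemma 5.2 (3) (proof)] [cite: Milne2025AbelianMotivesCharP, §1.5 Example 1.17]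
[cite: Deligne1982HodgeCycles, Milne 2003 re-edition endnote 16] -/
theorem hodgeConjectureFor_iff_weilClassesField_le_of_isIsogeny_of_hasHodgeGroupSUCM (hW : IsWeilTypeCM B θ R e₀ k)
    (hpol : IsPolarizationClass B.dim B.X h') (hRos : IsRosatiCM B θ h') (hSU : HasHodgeGroupSUCM B θ (R.comp (X ^ 2)) h')
    (hcup : IsEvenCupSubalgebra B.X (fun p => algebraicClasses B.X p)) (hf : AbelianVariety.IsIsogeny f)
    (hcomm : f ≫ θ = η ≫ f) :
    HodgeConjectureFor A.dim A.X ↔ weilClassesField A η (R.comp (X ^ 2)) (2 * k) ≤ algebraicClasses A.X k := by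
  obtain ⟨hW', hpol', hRos', hSU', -, -⟩ := weilTypeCM_generalMember_portrait_of_isIsogeny hW hpol hRos hSU hf hcomm
  exact hW'.hodgeConjectureFor_iff_weilClassesField_le_of_hodgeGroupSU hpol' hRos' hSU'
    (isEvenCupSubalgebra_algebraicClasses_of_isIsogeny hf hcup)

/-- … **`⟺ W_E(B) ⊗ ℂ ⊆ Nᵏ(B) ⊗ ℂ`** (algebraicity of the Weil classes is an isogeny invariant, tree
`weilClassesField_le_algebraicClasses_iff_of_isIsogeny_of_comm`). [cite: vanGeemen1994HodgeAV, 3.6–3.7 Lemma 3.7 (p. 236)]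
[cite: MoonenZarhin1998WeilClasses, §1] [cite: Milne2025AbelianMotivesCharP, §1.5 Example 1.17] -/
theorem hodgeConjectureFor_iff_weilClassesField_le_of_isIsogeny_of_hasHodgeGroupSUCM' (hW : IsWeilTypeCM B θ R e₀ k)
    (hpol : IsPolarizationClass B.dim B.X h') (hRos : IsRosatiCM B θ h') (hSU : HasHodgeGroupSUCM B θ (R.comp (X ^ 2)) h')
    (hcup : IsEvenCupSubalgebra B.X (fun p => algebraicClasses B.X p)) (hf : AbelianVariety.IsIsogeny f)
    (hcomm : f ≫ θ = η ≫ f) :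
    HodgeConjectureFor A.dim A.X ↔ weilClassesField B θ (R.comp (X ^ 2)) (2 * k) ≤ algebraicClasses B.X k :=
  (hodgeConjectureFor_iff_weilClassesField_le_of_isIsogeny_of_hasHodgeGroupSUCM hW hpol hRos hSU hcup hf hcomm).trans
    (weilClassesField_le_algebraicClasses_iff_of_isIsogeny_of_comm hf hcomm (R.comp (X ^ 2)) k)

/-- **`HC` on the whole isogeny class of a general CM-Weil `(B, θ, h')` from `W_E(B) ⊗ ℂ ⊆ Nᵏ(B) ⊗ ℂ`** (the inclusion form
of the sister file's `hodgeConjectureFor_of_isIsogenous_of_hasHodgeGroupSUCM`). [cite: Milne2025AbelianMotivesCharP, §1.5 Example 1.17]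
[cite: vanGeemen1994HodgeAV, 3.6–3.7 Lemma 3.7 (p. 236)] [cite: Deligne1982HodgeCycles, Milne 2003 re-edition endnote 16] -/
theorem hodgeConjectureFor_of_isIsogenous_of_hasHodgeGroupSUCM_of_le {C : AbelianVariety ℂ} (hW : IsWeilTypeCM B θ R e₀ k)
    (hpol : IsPolarizationClass B.dim B.X h') (hRos : IsRosatiCM B θ h') (hSU : HasHodgeGroupSUCM B θ (R.comp (X ^ 2)) h')
    (hcup : IsEvenCupSubalgebra B.X (fun p => algebraicClasses B.X p))
    (hle : weilClassesField B θ (R.comp (X ^ 2)) (2 * k) ≤ algebraicClasses B.X k) (hC : AbelianVariety.IsIsogenous C B) :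
    HodgeConjectureFor C.dim C.X :=
  (hodgeConjectureFor_iff_weilClassesField_le_of_isIsogenous_of_hasHodgeGroupSUCM hW hpol hRos hSU hcup hC).2 hle

end HodgeConjectureIff

/-! ### §3 Criteria of non-generality (`2k ≥ 4`) -/

section NonGenerality

variable {A : AbelianVariety ℂ} {η : A ⟶ A} {R : Polynomial ℤ} {e₀ k : ℕ} {h : complexBetti A.X 2}
variable (hW : IsWeilTypeCM A η R e₀ k) (hpol : IsPolarizationClass A.dim A.X h) (hRos : IsRosatiCM A η h) (hk : 2 ≤ k)

include hW hpol hRos hk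

/-- **A CM-Weil abelian variety OF CM TYPE is not a general member** (`Hg(A) ≠ SU(φ)`; `2k ≥ 4`): the general member is
not of CM type (`not_isOfCMType_of_hasHodgeGroupSUCM`). E.g. Deligne's products `∏ A_i` of CM abelian varieties (4.8 / 5)
are never general. [cite: Milne2025AbelianMotivesCharP, §1.5 1.16 and Example 1.17] [cite: Deligne1982HodgeCycles, §4 (4.8) and §5] -/
theorem not_hasHodgeGroupSUCM_of_isOfCMType (hCM : Milne1999.IsOfCMType A) : ¬ HasHodgeGroupSUCM A η (R.comp (X ^ 2)) h :=
  fun hSU ↦ not_isOfCMType_of_hasHodgeGroupSUCM hW hpol hRos hSU hk hCM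

/-- **A NON-SIMPLE CM-Weil abelian variety is not a general member** (`2k ≥ 4`). [cite: Milne2025AbelianMotivesCharP, §1.5 Example 1.17] -/
theorem not_hasHodgeGroupSUCM_of_not_isSimple (hA : ¬ AbelianVariety.IsSimple A) :
    ¬ HasHodgeGroupSUCM A η (R.comp (X ^ 2)) h :=
  fun hSU ↦ hA (isSimple_of_hasHodgeGroupSUCM hW hpol hRos hSU hk)

/-- **A CM-Weil abelian variety WITHOUT FACTOR OF TYPE IV is not a general member** (`2k ≥ 4`).
[cite: MoonenZarhin1999LowDim, §1 (type 4)] [cite: Milne2025AbelianMotivesCharP, §1.5 Example 1.17] -/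
theorem not_hasHodgeGroupSUCM_of_hasNoTypeIVFactor (h4 : HasNoTypeIVFactor A) : ¬ HasHodgeGroupSUCM A η (R.comp (X ^ 2)) h :=
  fun hSU ↦ not_hasNoTypeIVFactor_of_hasHodgeGroupSUCM hW hpol hRos hSU hk h4

/-- **`[End⁰(A) : ℚ] ≠ 2e₀ = [E : ℚ]` ⟹ not a general member** (`2k ≥ 4`). [cite: Milne2025AbelianMotivesCharP, §1.5 Example 1.17] -/
theorem not_hasHodgeGroupSUCM_of_finrank_endAlgebra_ne (hne : Module.finrank ℚ A.endAlgebra ≠ 2 * e₀) :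
    ¬ HasHodgeGroupSUCM A η (R.comp (X ^ 2)) h :=
  fun hSU ↦ hne (finrank_endAlgebra_eq_of_hasHodgeGroupSUCM hW hpol hRos hSU hk)

/-- **`End⁰(A)` not a field ⟹ not a general member** (`2k ≥ 4`). [cite: Milne2025AbelianMotivesCharP, §1.5 Example 1.17] -/
theorem not_hasHodgeGroupSUCM_of_not_isField_endAlgebra (hF : ¬ IsField A.endAlgebra) :
    ¬ HasHodgeGroupSUCM A η (R.comp (X ^ 2)) h :=
  fun hSU ↦ hF (isField_endAlgebra_of_hasHodgeGroupSUCM hW hpol hRos hSU hk)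

/-- **Two non-commuting endomorphisms ⟹ not a general member** (`2k ≥ 4`). [cite: Milne2025AbelianMotivesCharP, §1.5 Example 1.17] -/
theorem not_hasHodgeGroupSUCM_of_comp_ne_comp {φ' ψ : A ⟶ A} (hne : φ' ≫ ψ ≠ ψ ≫ φ') :
    ¬ HasHodgeGroupSUCM A η (R.comp (X ^ 2)) h :=
  fun hSU ↦ hne (comp_comm_of_hasHodgeGroupSUCM hW hpol hRos hSU hk φ' ψ)

/-- **`End⁰(A)` non-commutative ⟹ not a general member** (`2k ≥ 4`). [cite: Milne2025AbelianMotivesCharP, §1.5 Example 1.17] -/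
theorem not_hasHodgeGroupSUCM_of_endAlgebra_mul_ne {x y : A.endAlgebra} (hne : x * y ≠ y * x) :
    ¬ HasHodgeGroupSUCM A η (R.comp (X ^ 2)) h :=
  fun hSU ↦ hne (endAlgebra_mul_comm_of_hasHodgeGroupSUCM hW hpol hRos hSU hk x y)

end NonGenerality

end Literature.AlgebraicGeometry.Deligne1982

end
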